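import Summits.FinalStateConjecture.FinalStateConjecture.Theorems.BartnikGapSettlingBondiBartnikRigidityStationaryKerrCollarRoute
import Summits.FinalStateConjecture.FinalStateConjecture.Theorems.KerrShieldedSettles.Negative.OrientationAndHoleCollar
import Literature.Geometry.Lorentzian.KerrData
import Literature.Geometry.Lorentzian.CauchyHypersurfaceCausalProofs
import HarnessLib

/-!
# Stub `stub_roofDevelopmentExtension` (K2b = F5 of the K2 route) — worker file, wave 2 of lead a2
# (crux `BondiBartnikRigidity`, stmt-FinalStateConjecture-10807, line `direct-method-on-the-cone`)

**Verdict: the registered statement `K2Route.RoofDevelopmentExtension` is FALSE** (witness: the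
TIME-REVERSED Schwarzschild development; report `stub_roofDevelopmentExtension.report.md`, §2).
Mechanism: every hypothesis of the line's limit-category block (exact collar jet
`truncDeviationCk … ≤ 0`, layer embedding, core on the slice, maximality, roof charts) is blind to
the time orientation of `𝒱`, while the conclusion (exact INGOING Kerr-star boxes / charts inside
`J⁺_𝒱(C)`) is not.

This file (scratch; nothing here is landed) records, all kernel-checked (`lean check` rc 0,
0 sorries, 0 warnings):

* §0 TIME REVERSAL (proved, Literature-level): `K_{−ν} = −K_ν` (`secondFundamentalForm_neg`),
  `InitialDataSet.negK = (h, −k)`, `VacuumCauchyDevelopment.reverse : 𝒱 ↦ (M, g, −T, ι, −ν)`, a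
  vacuum Cauchy development of `(h, −k)`, MAXIMAL iff `𝒱` is (`IsMaximal.reverse`), with
  `J⁺_{𝒱.reverse} = J⁻_𝒱` (`causalFuture_reverse`); and §5 `collarBlock_reverse`: every
  hypothesis of the line's limit-category block transfers verbatim to `𝒱.reverse`;
* §1 the CURE — the orientation clause `CollarFutureOriented` (the collar chart pushes the
  Kerr-star time translation `Λ e₀`, future timelike on the strictly stationary shell, to a
  future-directed vector of `𝒱`) and the corrected statements `RoofDevelopmentExtensionOriented`
  (F5 + clause) and `RoofDevelopmentExtensionCollar` (F5 + clause, with the roof chart replaced by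
  a BOUNDARY-COLLAR chart `IsBoundaryCollarChart` that also covers the honest inner diamond
  `slabDiamondHalf = {0 < t*, t* + r/2 < 3M/2}` and agrees with `Φ₀` on the whole slab — the form
  the spacelike marching proof consumes without a corner lemma); the corrected K2
  (`K2Oriented`) and the CHECKED glue `K2Oriented_of_route` (the landed `OuterRoofChart`,
  `KerrLateBoxPlacement` compose with the corrected F5 exactly as before);
* §2 Kerr kinematics in the bundled star spacetime `Kerr.spacetime M a M` (proved): a vector is
  future-directed iff it is causal with `w⁰ > 0` (`t*` is a time function), and `g`-causal vectors
  are `η`-causal (speed limit) — the two facts on which the marching kites rest;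
* §3 bookkeeping of the Kerr-side sets (proved): `truncFutureK` is open and monotone, `pullK` of
  an open set along a star background is open (in the domain and in `E4`), `pullK` commutes with
  `∩`, `∪`;
* §4 the marching route for the corrected F5 as Lean SIGNATURES (`Prop`s, route-posited, nothing
  asserted): the two Kerr slab facts shared with K2c (`SlabFutureShift`, `SlabFrontier`), the
  past-set transfer lemma (`ExactChartPastSet`), the chart-gluing lemma (`ExactChartGluing`), the
  marching lemma (`MarchingLemma`), and the CHECKED reduction
  `roofDevelopmentExtensionCollar_of_marching : MarchingLemma → RoofDevelopmentExtensionCollar`.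

References: O'Neill 1983, Ch. 14 (Cauchy developments, time duality p. 403); Hawking–Ellis 1973,
§6.5, §7.6; Choquet-Bruhat–Geroch 1969, Thm. 3; Sbierski 2016, §3; Dafermos–Rodnianski
arXiv:0811.0354, §5.1 (Kerr-star chart).
-/

noncomputable section

set_option linter.dupNamespace false
set_option maxSynthPendingDepth 3

open Set Filter Function Topology TopologicalSpace Bundle
open Literature.Geometry.Lorentzian
open scoped Manifold ContDiff Topology ENNReal

/-! ## §0 Time reversal of vacuum Cauchy developments (the mechanism of the counterexample; proved) -/

namespace Literature.Geometry.Lorentzian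

/-! ### Linearity of the covariant derivative along a curve in the section: negation -/

section CovNeg

variable {E : Type*} [NormedAddCommGroup E] [NormedSpace ℝ E] {H : Type*} [TopologicalSpace H]
  {I : ModelWithCorners ℝ E H} {M : Type*} [TopologicalSpace M] [ChartedSpace H M]
  [IsManifold I ∞ M] [FiniteDimensional ℝ E]
  (cov : CovariantDerivative I E (TangentSpace I : M → Type _))

theorem covariantDerivAlong_neg (γ : ℝ → M) (W : Π t : ℝ, TangentSpace I (γ t)) (t₀ : ℝ) :
    covariantDerivAlong cov γ (fun t ↦ -W t) t₀ = -covariantDerivAlong cov γ W t₀ := by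
  simp only [covariantDerivAlong, covariantDerivAlongFrame, map_neg, neg_smul,
    Finset.sum_neg_distrib, neg_add]
  congr 1
  rw [← Finset.sum_neg_distrib]
  refine Finset.sum_congr rfl fun i _ ↦ ?_
  rw [← neg_smul]
  congr 1
  exact deriv.neg

end CovNeg

/-! ### Second fundamental form with respect to the opposite normal -/

section SFFNeg

variable {E : Type*} [NormedAddCommGroup E] [NormedSpace ℝ E] {H : Type*} [TopologicalSpace H]
  {I : ModelWithCorners ℝ E H} {M : Type*} [TopologicalSpace M] [ChartedSpace H M]
  {E' : Type*} [NormedAddCommGroup E'] [NormedSpace ℝ E'] {H' : Type*} [TopologicalSpace H']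
  {I' : ModelWithCorners ℝ E' H'} {N : Type*} [TopologicalSpace N] [ChartedSpace H' N]
  [IsManifold I ∞ M] {n : ℕ∞ω}
  [FiniteDimensional ℝ E] [CompleteSpace E] [Fact (1 ≤ n)]
  (g : PseudoRiemannianMetric I n E (TangentSpace I : M → Type _)) [g.HasLeviCivita] (f : N → M)
  (ν : NormalField I f)

namespace PseudoRiemannianMetric

omit [CompleteSpace E] [Fact (1 ≤ n)] in
/-- `D_v(−ν) = −D_v ν`. -/
theorem normalDerivAlong_neg (y : N) (v : TangentSpace I' y) :
    g.normalDerivAlong f (-ν) y v = -g.normalDerivAlong f ν y v :=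
  covariantDerivAlong_neg g.leviCivita _ _ 0

variable [FiniteDimensional ℝ E']

omit [CompleteSpace E] [Fact (1 ≤ n)] in
/-- **`K_{−ν} = −K_ν`**: the second fundamental form changes sign with the normal (O'Neill 1983,
Ch. 4, p. 100). -/
theorem secondFundamentalForm_neg (y : N) :
    g.secondFundamentalForm I' f (-ν) y = -g.secondFundamentalForm I' f ν y := by
  haveI : FiniteDimensional ℝ (TangentSpace I' y) := inferInstanceAs (FiniteDimensional ℝ E')
  unfold secondFundamentalForm
  have hfam : (fun i ↦ ((g.val (f y) (g.normalDerivAlong f (-ν) y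
      (Module.finBasis ℝ (TangentSpace I' y) i))).toLinearMap ∘ₗ (mfderiv I' I f y).toLinearMap)) =
      -(fun i ↦ ((g.val (f y) (g.normalDerivAlong f ν y
      (Module.finBasis ℝ (TangentSpace I' y) i))).toLinearMap ∘ₗ (mfderiv I' I f y).toLinearMap)) := by
    funext i
    simp only [Pi.neg_apply, normalDerivAlong_neg, map_neg, ContinuousLinearMap.toLinearMap_neg,
      LinearMap.neg_comp]
  rw [hfam, map_neg]

end PseudoRiemannianMetric

end SFFNeg

/-! ### Time reversal of data embeddings and (maximal) vacuum Cauchy developments -/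

section Reverse

universe u

variable {n : ℕ} {X : Type u} [TopologicalSpace X] [ChartedSpace (EuclideanSpace ℝ (Fin n)) X]
  [IsManifold (𝓡 n) ∞ X]

/-- The initial data set with the OPPOSITE second fundamental form, `(h, −k)`: the data induced
on the same hypersurface by the time-reversed development (future normal `−ν`). -/
def InitialDataSet.negK (D : InitialDataSet (𝓡 n) X) : InitialDataSet (𝓡 n) X where
  h := D.h
  k x := -D.k x
  k_symm x v w := by
    change -(D.k x v w) = -(D.k x w v)
    rw [D.k_symm]
  contMDiff_k := D.contMDiff_k.neg_section

@[simp]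
theorem InitialDataSet.negK_k (D : InitialDataSet (𝓡 n) X) (x : X) : D.negK.k x = -D.k x := rfl

@[simp]
theorem InitialDataSet.negK_h (D : InitialDataSet (𝓡 n) X) : D.negK.h = D.h := rfl

/-- The **time-reversed spacetime** `(M, g, −T)`. -/
abbrev Spacetime.reverse {d : ℕ} (𝒮 : Spacetime.{u} d) : Spacetime.{u} d where
  toLorentzianManifold := 𝒮.toLorentzianManifold
  timeOrientation := 𝒮.timeOrientation.reverse

section PastReverse

variable {E : Type*} [NormedAddCommGroup E] [NormedSpace ℝ E] {H : Type*} [TopologicalSpace H]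
  {I : ModelWithCorners ℝ E H} {M : Type*} [TopologicalSpace M] [ChartedSpace H M]
  [IsManifold I ∞ M] {m : ℕ∞ω} {g : LorentzianMetric I m M} (τ : TimeOrientation g) {x : M}

/-- Past-directed for the reversed orientation means future-directed. -/
theorem TimeOrientation.isPastDirected_reverse_iff (v : TangentSpace I x) :
    τ.reverse.IsPastDirected v ↔ τ.IsFutureDirected v := by
  rw [← TimeOrientation.isFutureDirected_neg_iff, TimeOrientation.isFutureDirected_reverse_iff,
    ← TimeOrientation.isFutureDirected_neg_iff, neg_neg]

end PastReverse

variable [ConnectedSpace X] {D : InitialDataSet (𝓡 n) X}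

/-- **Time reversal of a data embedding**, generic form: the same spacetime with the reversed
time orientation, the same embedding, the opposite normal `−ν`, is a data embedding of any data
set `D'` with `h' = h` and `k' = −k` (`K_{−ν} = −K_ν`, `secondFundamentalForm_neg`). -/
abbrev DataEmbedding.reverseTo (𝒮 : DataEmbedding D) (D' : InitialDataSet (𝓡 n) X)
    (hh : D'.h = D.h) (hk : ∀ x, D'.k x = -D.k x) : DataEmbedding D' where
  toSpacetime := 𝒮.toSpacetime.reverse
  embed := 𝒮.embed
  isSmoothEmbedding := 𝒮.isSmoothEmbedding
  normal := fun y ↦ -𝒮.normal y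
  isFutureUnitNormal := by
    refine ⟨⟨fun y v ↦ ?_, fun y ↦ ?_⟩, fun y ↦ ?_⟩
    · have h0 := 𝒮.isFutureUnitNormal.1.1 y v
      show 𝒮.metric.val (𝒮.embed y) (-𝒮.normal y) _ = 0
      simp only [map_neg, neg_apply, neg_eq_zero]
      exact h0
    · have h1 := 𝒮.isFutureUnitNormal.1.2 y
      show 𝒮.metric.val (𝒮.embed y) (-𝒮.normal y) (-𝒮.normal y) = -1
      simp only [map_neg, neg_apply, neg_neg]
      exact h1
    · show 𝒮.timeOrientation.reverse.IsFutureDirected (-𝒮.normal y)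
      rw [TimeOrientation.isFutureDirected_reverse_iff, ← TimeOrientation.isFutureDirected_neg_iff,
        neg_neg]
      exact 𝒮.isFutureUnitNormal.2 y
  induced_h := fun y ↦ by rw [hh]; exact 𝒮.induced_h y
  induced_k := by
    intro inst y
    haveI : 𝒮.metric.toPseudoRiemannianMetric.HasLeviCivita := inst
    show 𝒮.metric.toPseudoRiemannianMetric.secondFundamentalForm (𝓡 n) 𝒮.embed
      (-𝒮.normal) y = D'.kBilin y
    rw [PseudoRiemannianMetric.secondFundamentalForm_neg, 𝒮.induced_k y]
    refine LinearMap.ext fun v ↦ LinearMap.ext fun w ↦ ?_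
    simp only [LinearMap.neg_apply, InitialDataSet.kBilin_apply, hk, neg_apply]

/-- **Time reversal of a data embedding**: a data embedding of `(h, −k)`. -/
abbrev DataEmbedding.reverse (𝒮 : DataEmbedding D) : DataEmbedding D.negK :=
  𝒮.reverseTo D.negK rfl fun _ ↦ rfl

/-- … and back: a data embedding of `(h, −k)` reverses to one of `(h, k)`. -/
abbrev DataEmbedding.unreverse (𝒮 : DataEmbedding D.negK) : DataEmbedding D :=
  𝒮.reverseTo D rfl fun x ↦ by
    ext v w
    simp only [InitialDataSet.negK_k, neg_neg]

/-- Time reversal of a Cauchy development (the Cauchy property is time-symmetric,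
`IsCauchyHypersurface.reverse`). -/
abbrev CauchyDevelopment.reverseTo (𝒟 : CauchyDevelopment D) (D' : InitialDataSet (𝓡 n) X)
    (hh : D'.h = D.h) (hk : ∀ x, D'.k x = -D.k x) : CauchyDevelopment D' where
  toDataEmbedding := 𝒟.toDataEmbedding.reverseTo D' hh hk
  isCauchyHypersurface := 𝒟.isCauchyHypersurface.reverse

/-- Time reversal of a VACUUM Cauchy development (same metric, hence Ricci-flat). -/
abbrev VacuumCauchyDevelopment.reverseTo (𝒟 : VacuumCauchyDevelopment D) (D' : InitialDataSet (𝓡 n) X)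
    (hh : D'.h = D.h) (hk : ∀ x, D'.k x = -D.k x) : VacuumCauchyDevelopment D' where
  toCauchyDevelopment := 𝒟.toCauchyDevelopment.reverseTo D' hh hk
  isRicciFlat := by
    intro inst
    haveI : 𝒟.metric.toPseudoRiemannianMetric.HasLeviCivita := inst
    exact 𝒟.isRicciFlat

/-- The time-reversed vacuum Cauchy development, a development of `(h, −k)`. -/
abbrev VacuumCauchyDevelopment.reverse (𝒟 : VacuumCauchyDevelopment D) : VacuumCauchyDevelopment D.negK :=
  𝒟.reverseTo D.negK rfl fun _ ↦ rfl

/-- … and back. -/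
abbrev VacuumCauchyDevelopment.unreverse (𝒟 : VacuumCauchyDevelopment D.negK) : VacuumCauchyDevelopment D :=
  𝒟.reverseTo D rfl fun x ↦ by
    ext v w
    simp only [InitialDataSet.negK_k, neg_neg]

/-- The reversed development has the SAME underlying Lorentzian manifold (carrier, metric) and the
same embedding; only the time orientation and the normal change sign. -/
theorem VacuumCauchyDevelopment.reverse_toLorentzianManifold (𝒟 : VacuumCauchyDevelopment D) :
    𝒟.reverse.toLorentzianManifold = 𝒟.toLorentzianManifold ∧ 𝒟.reverse.embed = 𝒟.embed ∧
      𝒟.reverse.timeOrientation = 𝒟.timeOrientation.reverse ∧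
      𝒟.reverse.normal = fun y ↦ -𝒟.normal y :=
  ⟨rfl, rfl, rfl, rfl⟩

/-- **Embeddings of developments are time-symmetric**: the same map `ψ` embeds the reversed
developments (it is isometric for the same metrics and maps `−T₁` into the future of `−T₂`). -/
theorem DataEmbedding.EmbedsInto.reverseTo {D₁' : InitialDataSet (𝓡 n) X} {𝒮₁ 𝒮₂ : DataEmbedding D}
    (h : 𝒮₁.EmbedsInto 𝒮₂) (hh : D₁'.h = D.h) (hk : ∀ x, D₁'.k x = -D.k x) :
    (𝒮₁.reverseTo D₁' hh hk).EmbedsInto (𝒮₂.reverseTo D₁' hh hk) := by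
  obtain ⟨ψ, hs, ho, hi, hτ, hc⟩ := h
  refine ⟨ψ, hs, ho, hi, fun y ↦ ?_, hc⟩
  show 𝒮₂.timeOrientation.reverse.IsFutureDirected
    (mfderiv (𝓡 (n + 1)) (𝓡 (n + 1)) ψ y (-𝒮₁.timeOrientation.vectorField y))
  rw [map_neg, TimeOrientation.isFutureDirected_neg_iff, TimeOrientation.isPastDirected_reverse_iff]
  exact hτ y

/-- **Maximality is time-symmetric**: the time reversal of a maximal vacuum Cauchy development
of `(h, k)` is a maximal vacuum Cauchy development of `(h, −k)`.  (A development `𝒟'` of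
`(h, −k)` un-reverses to one of `(h, k)`, which embeds into `𝒟` by `ψ`; the same `ψ` embeds `𝒟'`
into the reversal of `𝒟`.) -/
theorem VacuumCauchyDevelopment.IsMaximal.reverse {𝒟 : VacuumCauchyDevelopment D} (h : 𝒟.IsMaximal) :
    𝒟.reverse.IsMaximal := by
  intro 𝒟'
  obtain ⟨ψ, hs, ho, hi, hτ, hc⟩ := h 𝒟'.unreverse
  refine ⟨ψ, hs, ho, hi, fun y ↦ ?_, hc⟩
  have hy : 𝒟.timeOrientation.IsFutureDirected
      (mfderiv (𝓡 (n + 1)) (𝓡 (n + 1)) ψ y (-𝒟'.timeOrientation.vectorField y)) := hτ y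
  show 𝒟.timeOrientation.reverse.IsFutureDirected
    (mfderiv (𝓡 (n + 1)) (𝓡 (n + 1)) ψ y (𝒟'.timeOrientation.vectorField y))
  rw [map_neg, TimeOrientation.isFutureDirected_neg_iff] at hy
  rwa [TimeOrientation.isFutureDirected_reverse_iff]

/-- Causal futures of the reversed development are causal pasts of the original one
(O'Neill 1983, Ch. 14, p. 403, time duality). -/
theorem VacuumCauchyDevelopment.causalFuture_reverse (𝒟 : VacuumCauchyDevelopment D) (S : Set 𝒟.carrier) :
    𝒟.reverse.metric.causalFuture 𝒟.reverse.timeOrientation S =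
      𝒟.metric.causalPast 𝒟.timeOrientation S := rfl

end Reverse

end Literature.Geometry.Lorentzian

namespace Summit.FinalStateConjecture.FinalStateConjecture.Theorems.BondiBartnikRigidity.DirectMethod

namespace K2Route

universe u

variable {X : Type u} [TopologicalSpace X] [ChartedSpace E3 X] [IsManifold (𝓡 3) ∞ X]
  [ConnectedSpace X] {D : InitialDataSet (𝓡 3) X}

/-! ## §1 The orientation clause and the corrected statements -/

/-- **The missing orientation clause of the limit-category block.**  On the strictly stationary
shell `{t* = 0, 2M < r ≤ 3M}` of each thick collar slab, the collar chart `Φᵢ` pushes the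
Kerr-star time translation `Λᵢ e₀ = ∂_{t*ᵢ}` of its frame — a future TIMELIKE vector of the
boosted Kerr form there (`g(∂_{t*}, ∂_{t*}) = −(1 − 2Mr/Σ) < 0` for `r > 2M`) — to a
FUTURE-directed vector of `𝒱`.  With the exact jet (C3) this says `dΦᵢ` preserves the time
orientation along the shell (hence, by connectedness, along the whole slab).  Without it the
block (C1)–(C3) + "core on the slice" is invariant under reversing the time orientation of `𝒱`,
which is how F1, F5 and the registered K2 fail (report §2).  A hypothesis clause; nothing is
asserted. [conjecture] [folklore] -/
def CollarFutureOriented (𝒱 : VacuumCauchyDevelopment D) {N : ℕ} (M : Fin N → ℝ)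
    (mo : Fin N → lorentzGroup × E4) (B : Fin N → ModelBackground)
    (Φ : ∀ i, (B i).domain → 𝒱.carrier) : Prop :=
  ∀ i, ∀ x ∈ (B i).truncTimeSlab (3 * M i) 0, 2 * M i < (B i).radius x.1 →
    𝒱.timeOrientation.IsFutureDirected
      (mfderiv 𝓘(ℝ, E4) (𝓡 4) (Φ i) x (((mo i).1 : E4 ≃L[ℝ] E4) (E4.basisVector 0)))

/-- **F5, corrected (minimal form): `RoofDevelopmentExtension` + the orientation clause.**
Verbatim the landed `K2Route.RoofDevelopmentExtension` with ONE inserted hypothesis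
(`CollarFutureOriented`, after the exact-jet clause).  TRUE on paper (report §4: spacelike
marching + the landed hypersurface localisation engine + a corner lemma at `S₃`).
Route-posited statement; nothing is asserted. [conjecture] [folklore] -/
def RoofDevelopmentExtensionOriented : Prop :=
  ∀ [Kerr.Facts] (k' : ℕ), 1 ≤ k' →
    ∀ (X : Type) [TopologicalSpace X] [ChartedSpace E3 X] [IsManifold (𝓡 3) ∞ X]
      [T2Space X] [SecondCountableTopology X] [ConnectedSpace X]
      (D : InitialDataSet (𝓡 3) X) (𝒱 : VacuumCauchyDevelopment D)
      (M a : Fin 1 → ℝ) (p : 𝒱.carrier) (mo : Fin 1 → lorentzGroup × E4)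
      (B : Fin 1 → ModelBackground) (Φ : ∀ i, (B i).domain → 𝒱.carrier)
      (hmax : 𝒱.IsMaximal) (hpar : ∀ i, 0 < M i ∧ |a i| < M i),
    (∃ i, p ∈ Φ i '' (B i).truncTimeSlab (3 * M i) 0) →
    (∀ i, B i = starBackground (mo i).1 (mo i).2 (M i) (a i)
      (fun x => Kerr.radius (a i) (poincareInv (mo i).1 (mo i).2 x))) →
    (∀ i, ContMDiffOn 𝓘(ℝ, E4) (𝓡 4) ∞ (Φ i)
        {x | -1 < (B i).time x.1 ∧ (B i).time x.1 < 1 ∧ (B i).radius x.1 < 3 * M i + 1} ∧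
      IsOpenEmbedding ({x | -1 < (B i).time x.1 ∧ (B i).time x.1 < 1 ∧
        (B i).radius x.1 < 3 * M i + 1}.restrict (Φ i))) →
    (∀ i, 𝒱.toSpacetime.truncDeviationCk (B i) (Φ i) k' (3 * M i) 0 ≤ 0) →
    CollarFutureOriented 𝒱 M mo B Φ →
    collarCore M p B Φ ⊆ range 𝒱.embed →
    (∀ ρ : ℝ, ∃ (O : Set (Kerr.region (a 0) (M 0))) (Ψ : (B 0).domain → 𝒱.carrier),
      IsRoofChart (mo 0) (M 0) (a 0) (hpar 0).1 (B 0) (collarCore M p B Φ)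
        (𝒱.metric.causalFuture 𝒱.timeOrientation (collarCore M p B Φ)) (Φ 0) ρ O Ψ) →
    ∀ ρ T₀ : ℝ, ∃ Ψ : (B 0).domain → 𝒱.carrier,
      ContMDiffOn 𝓘(ℝ, E4) (𝓡 4) ∞ Ψ (pullK (mo 0) (M 0) (a 0) (B 0) (truncFutureK (M 0) (a 0) (hpar 0).1 ρ T₀)) ∧
      IsOpenEmbedding ((pullK (mo 0) (M 0) (a 0) (B 0) (truncFutureK (M 0) (a 0) (hpar 0).1 ρ T₀)).restrict Ψ) ∧
      Ψ '' pullK (mo 0) (M 0) (a 0) (B 0) (truncFutureK (M 0) (a 0) (hpar 0).1 ρ T₀) ⊆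
        𝒱.metric.causalFuture 𝒱.timeOrientation (collarCore M p B Φ) ∧
      supCkENorm (Subtype.val '' pullK (mo 0) (M 0) (a 0) (B 0) (truncFutureK (M 0) (a 0) (hpar 0).1 ρ T₀)) 0
        (𝒱.toSpacetime.deviationExtend (B 0) Ψ) ≤ 0

/-- The Kerr-side HONEST future inner diamond `Δ½ = {0 < t*, t* + r/2 < 3M/2}` of the slab
(`u = t* + r/2` is a time function of the star chart for `|a| < M`, since
`Σ g⁻¹(du, du) = −Σ + Δ/4 < 0` on `{r > M}`; so `Δ½ ⊆ D⁺_Kerr(slab)`).  The landed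
`slabDiamond = {0 < t*, t* + r < 3M}` is NOT inside `D⁺_Kerr(slab)` for `a ≠ 0`: `dv`,
`v = t* + r`, is spacelike off the axis (`conormalForm_neg_one_pos`, landed), so near `S₃` the
wedge `{t* > 0, v < 3M}` is wider than the domain-of-dependence wedge bounded by the ingoing
null normal hypersurface of `S₃` (report §1(f)). -/
def slabDiamondHalfK (M a : ℝ) : Set (Kerr.region a M) :=
  {y | 0 < y.1 0 ∧ y.1 0 + Kerr.radius a y.1 / 2 < 3 * M / 2}

/-- **BOUNDARY-COLLAR CHART** (the hypothesis block the marching proof of F5 consumes): an exact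
chart `Ψ` of the collar background on the pull-back of the Kerr-side one-sided neighbourhood
`E = Δ½ ∪ (O ∩ J⁺_K(slab)°)` of the WHOLE lower boundary `slab ∪ (C⁺_K(S₃) ∩ {r ≤ ρ})` of the
open causal future of the slab — `O` an open neighbourhood of the roof portion —, smooth, an open
embedding, image in `J`, deviation `0`, continuous up to `slab ∪ roof portion`, EQUAL TO `Φ₀` ON
THE WHOLE SLAB (not only on `S₃`), and mapping the roof portion into `∂J⁺(C)`.  It is
`IsRoofChart` with the diamond adjoined and clause 9 strengthened from `S₃` to the slab; F4'
delivers it for free (its roof chart IS the continuation of the diamond chart of F1), and with it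
F5 needs no corner-compatibility lemma at `Φ₀(S₃)`.  A hypothesis block; nothing is asserted.
[conjecture] [folklore] -/
def IsBoundaryCollarChart [Kerr.Facts] {𝒮 : Spacetime.{0} 4} (mo : lorentzGroup × E4) (M a : ℝ) (hM : 0 < M)
    (B : ModelBackground) (C J : Set 𝒮.carrier) (Φ₀ : B.domain → 𝒮.carrier) (ρ : ℝ)
    (O : Set (Kerr.region a M)) (Ψ : B.domain → 𝒮.carrier) : Prop :=
  IsOpen O ∧ roofK M a hM ∩ {y | Kerr.radius a y.1 ≤ ρ} ⊆ O ∧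
  let E : Set (Kerr.region a M) := slabDiamondHalfK M a ∪ (O ∩ interior (JK M a hM (slabK M a)))
  ContMDiffOn 𝓘(ℝ, E4) (𝓡 4) ∞ Ψ (pullK mo M a B E) ∧
  IsOpenEmbedding ((pullK mo M a B E).restrict Ψ) ∧
  Ψ '' pullK mo M a B E ⊆ J ∧
  supCkENorm (Subtype.val '' pullK mo M a B E) 0 (𝒮.deviationExtend B Ψ) ≤ 0 ∧
  ContinuousOn Ψ (pullK mo M a B (E ∪ slabK M a ∪ (O ∩ roofK M a hM))) ∧
  Ψ '' pullK mo M a B (O ∩ roofK M a hM) ⊆ frontier (𝒮.metric.causalFuture 𝒮.timeOrientation C) ∧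
  ∀ x ∈ pullK mo M a B (slabK M a), Ψ x = Φ₀ x

/-- **F5, corrected (recommended form): boundary-collar charts ⟹ the truncated causal future is
Kerr.**  As `RoofDevelopmentExtensionOriented` but with `IsBoundaryCollarChart` in place of
`IsRoofChart`.  TRUE on paper by SPACELIKE marching (report §4): level by level, the exact slice
piece `{t* = τ} ∩ J⁺_K(slab)°` is an acausal hypersurface datum of `𝒱` (past-set transfer),
whose Kerr kite development is realised inside the MAXIMAL `𝒱` by the landed hypersurface
localisation engine (`CaptureSufficesC2.Sketch.stub_hypersurfaceMGHDRealised_of_choquetBruhatGeroch`,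
conditional on `choquetBruhat_geroch_exists_mghd_cauchy` only), glued to the previous chart by
one-jet rigidity (`IsIsometricImmersion.eq_of_oneJet_eq`), the strip lost near the roof at each
step being refilled by the collar.  Route-posited statement; nothing is asserted.
[conjecture] [folklore] -/
def RoofDevelopmentExtensionCollar : Prop :=
  ∀ [Kerr.Facts] (k' : ℕ), 1 ≤ k' →
    ∀ (X : Type) [TopologicalSpace X] [ChartedSpace E3 X] [IsManifold (𝓡 3) ∞ X]
      [T2Space X] [SecondCountableTopology X] [ConnectedSpace X]
      (D : InitialDataSet (𝓡 3) X) (𝒱 : VacuumCauchyDevelopment D)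
      (M a : Fin 1 → ℝ) (p : 𝒱.carrier) (mo : Fin 1 → lorentzGroup × E4)
      (B : Fin 1 → ModelBackground) (Φ : ∀ i, (B i).domain → 𝒱.carrier)
      (hmax : 𝒱.IsMaximal) (hpar : ∀ i, 0 < M i ∧ |a i| < M i),
    (∃ i, p ∈ Φ i '' (B i).truncTimeSlab (3 * M i) 0) →
    (∀ i, B i = starBackground (mo i).1 (mo i).2 (M i) (a i)
      (fun x => Kerr.radius (a i) (poincareInv (mo i).1 (mo i).2 x))) →
    (∀ i, ContMDiffOn 𝓘(ℝ, E4) (𝓡 4) ∞ (Φ i)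
        {x | -1 < (B i).time x.1 ∧ (B i).time x.1 < 1 ∧ (B i).radius x.1 < 3 * M i + 1} ∧
      IsOpenEmbedding ({x | -1 < (B i).time x.1 ∧ (B i).time x.1 < 1 ∧
        (B i).radius x.1 < 3 * M i + 1}.restrict (Φ i))) →
    (∀ i, 𝒱.toSpacetime.truncDeviationCk (B i) (Φ i) k' (3 * M i) 0 ≤ 0) →
    CollarFutureOriented 𝒱 M mo B Φ →
    collarCore M p B Φ ⊆ range 𝒱.embed →
    (∀ ρ : ℝ, ∃ (O : Set (Kerr.region (a 0) (M 0))) (Ψ : (B 0).domain → 𝒱.carrier),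
      IsBoundaryCollarChart (mo 0) (M 0) (a 0) (hpar 0).1 (B 0) (collarCore M p B Φ)
        (𝒱.metric.causalFuture 𝒱.timeOrientation (collarCore M p B Φ)) (Φ 0) ρ O Ψ) →
    ∀ ρ T₀ : ℝ, ∃ Ψ : (B 0).domain → 𝒱.carrier,
      ContMDiffOn 𝓘(ℝ, E4) (𝓡 4) ∞ Ψ (pullK (mo 0) (M 0) (a 0) (B 0) (truncFutureK (M 0) (a 0) (hpar 0).1 ρ T₀)) ∧
      IsOpenEmbedding ((pullK (mo 0) (M 0) (a 0) (B 0) (truncFutureK (M 0) (a 0) (hpar 0).1 ρ T₀)).restrict Ψ) ∧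
      Ψ '' pullK (mo 0) (M 0) (a 0) (B 0) (truncFutureK (M 0) (a 0) (hpar 0).1 ρ T₀) ⊆
        𝒱.metric.causalFuture 𝒱.timeOrientation (collarCore M p B Φ) ∧
      supCkENorm (Subtype.val '' pullK (mo 0) (M 0) (a 0) (B 0) (truncFutureK (M 0) (a 0) (hpar 0).1 ρ T₀)) 0
        (𝒱.toSpacetime.deviationExtend (B 0) Ψ) ≤ 0

/-- **K2, corrected**: the registered K2 signature with the orientation clause inserted (after the
exact-jet clause).  The registered K2 is false by the same time-reversed witness (report §2(c)).
Route-posited statement; nothing is asserted. [conjecture] [folklore] -/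
def K2Oriented : Prop :=
  ∀ (k' : ℕ), 2 ≤ k' →
    ∀ (X : Type) [TopologicalSpace X] [ChartedSpace E3 X] [IsManifold (𝓡 3) ∞ X]
      [T2Space X] [SecondCountableTopology X] [ConnectedSpace X]
      (D : InitialDataSet (𝓡 3) X) (𝒱 : VacuumCauchyDevelopment D)
      (M a : Fin 1 → ℝ) (p : 𝒱.carrier) (mo : Fin 1 → lorentzGroup × E4)
      (B : Fin 1 → ModelBackground) (Φ : ∀ i, (B i).domain → 𝒱.carrier),
    𝒱.IsMaximal → (∀ i, 0 < M i ∧ |a i| < M i) →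
    (∃ i, p ∈ Φ i '' (B i).truncTimeSlab (3 * M i) 0) →
    (∀ i, B i = starBackground (mo i).1 (mo i).2 (M i) (a i)
      (fun x => Kerr.radius (a i) (poincareInv (mo i).1 (mo i).2 x))) →
    (∀ i, ContMDiffOn 𝓘(ℝ, E4) (𝓡 4) ∞ (Φ i)
        {x | -1 < (B i).time x.1 ∧ (B i).time x.1 < 1 ∧ (B i).radius x.1 < 3 * M i + 1} ∧
      IsOpenEmbedding ({x | -1 < (B i).time x.1 ∧ (B i).time x.1 < 1 ∧
        (B i).radius x.1 < 3 * M i + 1}.restrict (Φ i))) →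
    (∀ i, 𝒱.toSpacetime.truncDeviationCk (B i) (Φ i) k' (3 * M i) 0 ≤ 0) →
    CollarFutureOriented 𝒱 M mo B Φ →
    collarCore M p B Φ ⊆ range 𝒱.embed →
    (∃ m : ℝ, 𝒱.toCauchyDevelopment.HasCutBondiMass (collarCore M p B Φ) m) →
    ∀ [𝒱.metric.toPseudoRiemannianMetric.HasLeviCivita],
    ∀ (ξ : Π x : 𝒱.carrier, TangentSpace (𝓡 4) x),
    𝒱.metric.IsKillingFieldOn ξ (interior (killingDomain 𝒱 M p B Φ)) →
    (∃ (τ₁ r₁ r₂ : ℝ) (Ψ : (B 0).domain → 𝒱.carrier),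
        0 < τ₁ ∧ 2 * M 0 ≤ r₁ ∧ r₁ < r₂ ∧ r₂ ≤ 3 * M 0 ∧
        IsNearModelBox 𝒱.toSpacetime (B 0) k' 0 0 τ₁ r₁ r₂ (interior (killingDomain 𝒱 M p B Φ)) Ψ ∧
        ∀ x ∈ coordBox (B 0) 0 τ₁ r₁ r₂,
          ξ (Ψ x) = mfderiv 𝓘(ℝ, E4) (𝓡 4) Ψ x (((mo 0).1 : E4 ≃L[ℝ] E4) (E4.basisVector 0))) →
    ∀ (k : ℕ) (R T : ℝ), ∃ (τ : ℝ) (Ψ : (B 0).domain → 𝒱.carrier),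
      IsNearModelBox 𝒱.toSpacetime (B 0) k 0 τ (τ + T) (M 0) (R + 1)
        (𝒱.metric.causalFuture 𝒱.timeOrientation (collarCore M p B Φ)) Ψ

/-- **The corrected K2 follows from the landed F4', the corrected F5 and the landed F6** (the glue
is the landed `K2_of_route` verbatim, the orientation clause being passed to F5 and ignored by
F4'; the Kerr chart facts `[Kerr.Facts]` are discharged). -/
theorem K2Oriented_of_route (h4 : OuterRoofChart) (h5 : RoofDevelopmentExtensionOriented)
    (h6 : KerrLateBoxPlacement) : K2Oriented := by
  haveI : Kerr.Facts :=
    ⟨Kerr.isConnected_region_holds, Kerr.contMDiff_bilin_holds, Kerr.contMDiff_timeVector_holds⟩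
  intro k' hk' X _ _ _ _ _ _ D 𝒱 M a p mo B Φ hmax hpar hp hB hΦ hdev hor hCX hcut _ ξ hξ hbox k R T
  -- F4': roof charts (image in `interior killingDomain ⊆ J⁺(C)`)
  have hroof := h4 k' hk' X D 𝒱 M a p mo B Φ hmax hpar hp hB hΦ hdev hCX hcut ξ hξ hbox
  have hroof' : ∀ ρ : ℝ, ∃ (O : Set (Kerr.region (a 0) (M 0))) (Ψ : (B 0).domain → 𝒱.carrier),
      IsRoofChart (mo 0) (M 0) (a 0) (hpar 0).1 (B 0) (collarCore M p B Φ)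
        (𝒱.metric.causalFuture 𝒱.timeOrientation (collarCore M p B Φ)) (Φ 0) ρ O Ψ := by
    intro ρ
    obtain ⟨O, Ψ, ⟨hO, hsub, hs, he, hJ, hd, hc, hfr, hS⟩, -⟩ := hroof ρ
    exact ⟨O, Ψ, hO, hsub, hs, he,
      hJ.trans (interior_subset.trans (killingDomain_subset_causalFuture 𝒱 M p B Φ)), hd, hc, hfr, hS⟩
  -- F5 (corrected): exact chart on the truncated causal future, for every `ρ, T₀`
  have hext := h5 k' (le_trans one_le_two hk') X D 𝒱 M a p mo B Φ hmax hpar hp hB hΦ hdev hor hCX hroof'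
  -- F6: place the box
  obtain ⟨τ, ρ, T₀, hplace⟩ := h6 (M 0) (a 0) R T (hpar 0).1 (hpar 0).2
  obtain ⟨Ψ, hs, he, hJ, hd⟩ := hext ρ T₀
  refine ⟨τ, Ψ, ?_⟩
  have hsub : coordBox (B 0) τ (τ + T) (M 0) (R + 1) ⊆
      pullK (mo 0) (M 0) (a 0) (B 0) (truncFutureK (M 0) (a 0) (hpar 0).1 ρ T₀) :=
    (coordBox_subset_pullK_boxK (hB 0) τ (τ + T) (M 0) (R + 1)).trans (pullK_mono _ _ _ _ hplace)
  have hopen : IsOpen (coordBox (B 0) τ (τ + T) (M 0) (R + 1)) := by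
    rw [hB 0]
    exact isOpen_coordBox (continuous_time_starBackground _ _ _ _ _)
      (continuous_radius_starBackground _ _ _ _) _ _ _ _
  exact isNearModelBox_of_exactOn hs he hJ hd hsub hopen
    (isOpen_image_val_coordBox_of_eq_starBackground (hB 0) _ _ _ _) k


/-! ## §2 Kerr kinematics in the bundled star spacetime (proved) -/

section KerrKinematics

open Summit.FinalStateConjecture.FinalStateConjecture.Theorems.KerrShieldedSettles.Negative
  (minkowski_le_bilin spatial_sq_le_of_causal bilin_timeVector_neg_iff)

variable [Kerr.Facts]

/-- **`t*` is a time function of the Kerr star spacetime**: a tangent vector `w` at a point of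
`Kerr.spacetime M a r₀` (`0 ≤ M`) is future-directed for the tree's orientation `V = −g♯dt*` iff
it is causal with `dt*(w) = w⁰ > 0` (`g(V, w) = −w⁰`, `Kerr.bilin_timeVector`).  Hence `t*`
strictly increases along future causal curves, its level sets `{t* = τ}` are acausal, and
`J⁺_K(slab) ⊆ {t* ≥ 0}`. (Dafermos–Rodnianski arXiv:0811.0354, §5.1.) -/
theorem spacetime_isFutureDirected_iff {M a r₀ : ℝ} (hM : 0 ≤ M) (x : Kerr.region a r₀) (w : E4) :
    (Kerr.spacetime M a r₀ hM).timeOrientation.IsFutureDirected (x := x) w ↔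
      (Kerr.spacetime M a r₀ hM).metric.IsCausal (x := x) w ∧ 0 < w 0 := by
  rw [TimeOrientation.isFutureDirected_iff]
  exact and_congr Iff.rfl (bilin_timeVector_neg_iff (Kerr.radius_pos_of_mem_region x.2) w)

/-- **Speed limit** (`J⁺_g ⊆ J⁺_η`): the Kerr–Schild form dominates the Minkowski form on the
diagonal, `η(w, w) ≤ g_{M,a}(w, w)` (`g = η + 2H ℓ ⊗ ℓ`, `H ≥ 0` for `M ≥ 0`), so every
`g`-causal vector of the Kerr star spacetime is `η`-causal: `|w⃗|² ≤ (w⁰)²`.  Along a future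
causal curve the Euclidean spatial displacement is therefore at most the lapse of `t*` — the
erosion rate of the marching kites. (Dafermos–Rodnianski arXiv:0811.0354, §5.1.) -/
theorem spacetime_spatial_sq_le_of_isCausal {M a r₀ : ℝ} (hM : 0 ≤ M) (x : Kerr.region a r₀) (w : E4)
    (hw : (Kerr.spacetime M a r₀ hM).metric.IsCausal (x := x) w) :
    w 1 ^ 2 + w 2 ^ 2 + w 3 ^ 2 ≤ (w 0) ^ 2 :=
  spatial_sq_le_of_causal hM a x.1 w hw.1

/-- The diagonal comparison `η(w, w) ≤ g(w, w)` in the bundled star spacetime. -/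
theorem spacetime_minkowski_le_val {M a r₀ : ℝ} (hM : 0 ≤ M) (x : Kerr.region a r₀) (w : E4) :
    Minkowski.bilin w w ≤ (Kerr.spacetime M a r₀ hM).metric.val x w w :=
  minkowski_le_bilin hM a x.1 w

/-- A future-directed vector of the Kerr star spacetime has positive `t*`-component and
`η`-causal direction: `|w⃗|² ≤ (w⁰)²`, `0 < w⁰`. -/
theorem spacetime_isFutureDirected.pos_and_spatial_le {M a r₀ : ℝ} (hM : 0 ≤ M)
    (x : Kerr.region a r₀) (w : E4)
    (hw : (Kerr.spacetime M a r₀ hM).timeOrientation.IsFutureDirected (x := x) w) :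
    0 < w 0 ∧ w 1 ^ 2 + w 2 ^ 2 + w 3 ^ 2 ≤ (w 0) ^ 2 :=
  ⟨((spacetime_isFutureDirected_iff hM x w).1 hw).2,
    spacetime_spatial_sq_le_of_isCausal hM x w ((spacetime_isFutureDirected_iff hM x w).1 hw).1⟩

end KerrKinematics

/-! ## §3 Bookkeeping of the Kerr-side sets (proved) -/

section KerrSideSets

variable [Kerr.Facts]

omit [Kerr.Facts] in
/-- The `t*`-coordinate is continuous on the Kerr chart domain. -/
theorem continuous_tstar (a r₀ : ℝ) : Continuous fun y : Kerr.region a r₀ => y.1 0 :=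
  (PiLp.continuous_apply 2 (fun _ : Fin 4 => ℝ) 0).comp continuous_subtype_val

omit [Kerr.Facts] in
/-- The Kerr–Schild radius is continuous on the Kerr chart domain. -/
theorem continuous_radius_region (a r₀ : ℝ) : Continuous fun y : Kerr.region a r₀ => Kerr.radius a y.1 :=
  (Kerr.continuous_radius a).comp continuous_subtype_val

/-- **`truncFutureK` is open** (interior ∩ two open sublevel conditions). -/
theorem isOpen_truncFutureK (M a : ℝ) (hM : 0 < M) (ρ T₀ : ℝ) : IsOpen (truncFutureK M a hM ρ T₀) :=
  isOpen_interior.inter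
    ((isOpen_lt (continuous_tstar a M) continuous_const).inter
      (isOpen_lt (continuous_radius_region a M) continuous_const))

/-- `truncFutureK` is monotone in `(ρ, T₀)`. -/
theorem truncFutureK_mono (M a : ℝ) (hM : 0 < M) {ρ ρ' T₀ T₀' : ℝ} (hρ : ρ ≤ ρ') (hT : T₀ ≤ T₀') :
    truncFutureK M a hM ρ T₀ ⊆ truncFutureK M a hM ρ' T₀' :=
  fun _ h ↦ ⟨h.1, h.2.1.trans_le hT, h.2.2.trans_le hρ⟩

/-- `truncFutureK ρ T₀ ⊆ J⁺_K(slab)° ∩ {t* < T₀}` (drop the radius truncation). -/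
theorem truncFutureK_subset (M a : ℝ) (hM : 0 < M) (ρ T₀ : ℝ) :
    truncFutureK M a hM ρ T₀ ⊆ interior (JK M a hM (slabK M a)) ∩ {y | y.1 0 < T₀} :=
  fun _ h ↦ ⟨h.1, h.2.1⟩

/-- `J⁺_K(slab)° ∩ {t* < T₀}` is open. -/
theorem isOpen_interior_JK_inter_lt (M a : ℝ) (hM : 0 < M) (T₀ : ℝ) :
    IsOpen (interior (JK M a hM (slabK M a)) ∩ {y | y.1 0 < T₀}) :=
  isOpen_interior.inter (isOpen_lt (continuous_tstar a M) continuous_const)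

omit [Kerr.Facts] in
/-- The identification `x ↦ Λ⁻¹(x − c)` of the star-background domain with the Kerr chart domain
is continuous. -/
theorem continuous_toKerr (mo : lorentzGroup × E4) (M a : ℝ) (r : E4 → ℝ) :
    Continuous fun x : (starBackground mo.1 mo.2 M a r).domain =>
      (⟨poincareInv mo.1 mo.2 x.1, x.2⟩ : Kerr.region a M) :=
  ((continuous_poincareInv mo.1 mo.2).comp continuous_subtype_val).subtype_mk _

omit [Kerr.Facts] in
/-- For the star background, `pullK` is the preimage under the identification map. -/
theorem pullK_starBackground (mo : lorentzGroup × E4) (M a : ℝ) (r : E4 → ℝ)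
    (S : Set (Kerr.region a M)) :
    pullK mo M a (starBackground mo.1 mo.2 M a r) S =
      (fun x : (starBackground mo.1 mo.2 M a r).domain =>
        (⟨poincareInv mo.1 mo.2 x.1, x.2⟩ : Kerr.region a M)) ⁻¹' S := by
  ext x
  exact ⟨fun ⟨_, h⟩ => h, fun h => ⟨x.2, h⟩⟩

omit [Kerr.Facts] in
/-- **The pull-back of an OPEN Kerr-side set is open** in the domain of the collar background. -/
theorem isOpen_pullK_of_eq {mo : lorentzGroup × E4} {M a : ℝ} {B : ModelBackground}
    (hB : B = starBackground mo.1 mo.2 M a (fun x => Kerr.radius a (poincareInv mo.1 mo.2 x)))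
    {S : Set (Kerr.region a M)} (hS : IsOpen S) : IsOpen (pullK mo M a B S) := by
  subst hB
  rw [pullK_starBackground]
  exact hS.preimage (continuous_toKerr mo M a _)

omit [Kerr.Facts] in
/-- … and its image in `E4` is open (the openness side condition of `isNearModelBox_of_exactOn` /
`IsNearModelBox.of_exact_order_zero` for pulled-back Kerr-side regions). -/
theorem isOpen_image_val_pullK_of_eq {mo : lorentzGroup × E4} {M a : ℝ} {B : ModelBackground}
    (hB : B = starBackground mo.1 mo.2 M a (fun x => Kerr.radius a (poincareInv mo.1 mo.2 x)))
    {S : Set (Kerr.region a M)} (hS : IsOpen S) : IsOpen (Subtype.val '' pullK mo M a B S) :=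
  B.domain.isOpen.isOpenMap_subtype_val _ (isOpen_pullK_of_eq hB hS)

omit [Kerr.Facts] in
/-- `pullK` commutes with intersections. -/
theorem pullK_inter (mo : lorentzGroup × E4) (M a : ℝ) (B : ModelBackground)
    (S T : Set (Kerr.region a M)) : pullK mo M a B (S ∩ T) = pullK mo M a B S ∩ pullK mo M a B T := by
  ext x
  exact ⟨fun ⟨h, hS, hT⟩ => ⟨⟨h, hS⟩, ⟨h, hT⟩⟩, fun ⟨⟨h, hS⟩, ⟨_, hT⟩⟩ => ⟨h, hS, hT⟩⟩

omit [Kerr.Facts] in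
/-- `pullK` commutes with unions. -/
theorem pullK_union (mo : lorentzGroup × E4) (M a : ℝ) (B : ModelBackground)
    (S T : Set (Kerr.region a M)) : pullK mo M a B (S ∪ T) = pullK mo M a B S ∪ pullK mo M a B T := by
  ext x
  constructor
  · rintro ⟨h, hS | hT⟩
    exacts [Or.inl ⟨h, hS⟩, Or.inr ⟨h, hT⟩]
  · rintro (⟨h, hS⟩ | ⟨h, hT⟩)
    exacts [⟨h, Or.inl hS⟩, ⟨h, Or.inr hT⟩]

omit [Kerr.Facts] in
/-- **Restriction of an exact chart to an open Kerr-side sub-region.**  If `Ψ` is smooth on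
`pullK Q`, an open embedding of it, maps it into `J` with vanishing deviation, and `S ⊆ Q` is
open on the Kerr side, then the same four clauses hold on `pullK S` (the restriction step of the
reduction `MarchingLemma → F5`). -/
theorem exactOn_pullK_mono {𝒮 : Spacetime.{0} 4} {mo : lorentzGroup × E4} {M a : ℝ} {B : ModelBackground}
    (hB : B = starBackground mo.1 mo.2 M a (fun x => Kerr.radius a (poincareInv mo.1 mo.2 x)))
    {Q S : Set (Kerr.region a M)} {J : Set 𝒮.carrier} {Ψ : B.domain → 𝒮.carrier}
    (hs : ContMDiffOn 𝓘(ℝ, E4) (𝓡 4) ∞ Ψ (pullK mo M a B Q))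
    (he : IsOpenEmbedding ((pullK mo M a B Q).restrict Ψ))
    (hJ : Ψ '' pullK mo M a B Q ⊆ J)
    (hd : supCkENorm (Subtype.val '' pullK mo M a B Q) 0 (𝒮.deviationExtend B Ψ) ≤ 0)
    (hSQ : S ⊆ Q) (hS : IsOpen S) :
    ContMDiffOn 𝓘(ℝ, E4) (𝓡 4) ∞ Ψ (pullK mo M a B S) ∧
      IsOpenEmbedding ((pullK mo M a B S).restrict Ψ) ∧
      Ψ '' pullK mo M a B S ⊆ J ∧
      supCkENorm (Subtype.val '' pullK mo M a B S) 0 (𝒮.deviationExtend B Ψ) ≤ 0 := by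
  have hsub : pullK mo M a B S ⊆ pullK mo M a B Q := pullK_mono _ _ _ _ hSQ
  refine ⟨hs.mono hsub, ?_, (image_mono hsub).trans hJ, (supCkENorm_mono (image_mono hsub) 0 _).trans hd⟩
  have hincl : IsOpenEmbedding (Set.inclusion hsub) :=
    .inclusion hsub (continuous_subtype_val.isOpen_preimage _ (isOpen_pullK_of_eq hB hS))
  exact he.comp hincl

end KerrSideSets

/-! ## §4 The marching route for the corrected F5: signatures and the checked reduction -/

section Marching

/-- Kerr-side causal past `J⁻_K` of the star spacetime `Kerr.spacetime M a M`. -/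
def JKpast [Kerr.Facts] (M a : ℝ) (hM : 0 < M) (S : Set (Kerr.region a M)) : Set (Kerr.region a M) :=
  (Kerr.spacetime M a M hM.le).metric.causalPast (Kerr.spacetime M a M hM.le).timeOrientation S

/-- **Shared Kerr fact 1 (with K2c / F6): the causal future of the slab contains the solid
cylinder over it**, `J⁺_K(slab) ⊇ {t* ≥ 0, M < r ≤ 3M}` (`0 < M`, `|a| < M`).  Paper proof: from
`(t*, r)` with `M < r ≤ r₊` follow the outgoing principal null ray to the PAST (inside `r < r₊`
the radius increases pastward towards `r₊`, `t* → −∞`), from `r₊ < r ≤ 3M` the same ray (radius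
decreasing pastward towards `r₊`); both cross `{t* = 0}` inside the slab.  Consequences used by
the marching: `J⁺_K(slab)° + s e₀ ⊆ J⁺_K(slab)°` for `s ≥ 0` (with the `t*`-translation isometry,
`KerrSchildTimeTranslation`), and `W ∩ {t* ≤ h} ⊆ Δ½ ∪ N_{2h}(roofK)`.  MISSING (explicit Kerr
curves; closable). (ref: DafermosRodnianski2008, §5.1) (ref: ONeill1995, Ch. 4)
Route-posited statement; nothing is asserted. [conjecture] [folklore] -/
def SlabFutureContainsCylinder : Prop :=
  ∀ [Kerr.Facts] (M a : ℝ) (hM : 0 < M), |a| < M →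
    {y : Kerr.region a M | 0 ≤ y.1 0 ∧ Kerr.radius a y.1 ≤ 3 * M} ⊆ JK M a hM (slabK M a)

/-- **Shared Kerr fact 2 (with K2c): the frontier of `J⁺_K(slab)` off the slab is ruled from the
outer edge sphere**, `∂J⁺_K(slab) ⊆ slab ∪ J⁺_K(S₃)` — so that `∂(J⁺_K(slab)°) ⊆ slabK ∪ roofK`
(no "inner sheet" inside `{r > M}`: points `(t* > 0, r ↓ M)` are interior by fact 1).  Paper
proof: a frontier point `x ∉ slab` lies on a null geodesic from the slab without interior slab
points to its past (those would put `x` in `I⁺(slab)`), hence from the edge `S₃` (the inner edge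
`{r = M}` is not in the chart).  MISSING (achronal-boundary structure of `∂J⁺` in the star chart;
closable from `CausalityBoundary.lean`). (ref: HawkingEllis1973CUP, §6.3, Prop. 6.3.1)
Route-posited statement; nothing is asserted. [conjecture] [folklore] -/
def SlabFrontier : Prop :=
  ∀ [Kerr.Facts] (M a : ℝ) (hM : 0 < M), |a| < M →
    frontier (JK M a hM (slabK M a)) ⊆ slabK M a ∪ JK M a hM (outerSphereK M a)

variable {X : Type} [TopologicalSpace X] [ChartedSpace E3 X] [IsManifold (𝓡 3) ∞ X]
  [ConnectedSpace X] {D : InitialDataSet (𝓡 3) X}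

/-- **Past-set transfer lemma** (the causal bookkeeping step (C) of the marching; soft, no Kerr
computation beyond compactness of truncated pasts).  Let `P ⊆ W := J⁺_K(slab)°` be an OPEN
Kerr-side set which is PAST-CLOSED in `W` in the closed form (the closure of `J⁻_K(x)`, `x ∈ P`,
meets `W` inside `P`, meets `∂W` inside `slab ∪ (roofK ∩ {r ≤ ρ})`, and is compact), and `Ψ` an
exact, time-orientation preserving chart on `pullK P` with image in `J⁺(C)`, continuous up to
`slab ∪ roof portion`, equal to `Φ₀` on the slab (`Φ₀(slab) ⊆ C ⊆ ι X`) and mapping the roof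
portion into `∂J⁺(C)`.  Then `Ψ(pullK P)` is past-closed in `I⁺(C)`:
`J⁻_𝒱(Ψ x) ∩ I⁺_𝒱(C) ⊆ Ψ(pullK P)` for every `x ∈ pullK P`.  Paper proof: lift a past causal
curve of `𝒱` from `Ψ x` through the open embedding `Ψ`; the lift is a Kerr past causal curve in
`J⁻_K(x) ∩ W`; at a first exit parameter its limit point `z` exists (compactness) and lies in `P`
(then no exit), on the slab (then the `𝒱`-curve reaches `ι X` from `I⁺(C) ⊆ I⁺(ι X)` —
chronology of the Cauchy hypersurface) or on the roof (then it reaches `∂J⁺(C)` from `I⁺(C)`,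
which is a future set disjoint from `∂J⁺(C)`).  Consequences: `Ψ(P ∩ {t* = τ})` is ACAUSAL in `𝒱`
(pull back a causal chord), and glued charts are injective.  MISSING (formalisable now: curve
lifting through open embeddings `TimelikeCurveLift*`, push-up `CausalityPushUp`, achronality of
`range 𝒱.embed`). (ref: HawkingEllis1973CUP, §6.5) Route-posited statement; nothing is asserted.
[conjecture] [folklore] -/
def ExactChartPastSet : Prop :=
  ∀ [Kerr.Facts] (X : Type) [TopologicalSpace X] [ChartedSpace E3 X] [IsManifold (𝓡 3) ∞ X]
    [T2Space X] [SecondCountableTopology X] [ConnectedSpace X]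
    (D : InitialDataSet (𝓡 3) X) (𝒱 : VacuumCauchyDevelopment D)
    (M a : ℝ) (hM : 0 < M) (mo : lorentzGroup × E4) (B : ModelBackground)
    (Φ₀ Ψ : B.domain → 𝒱.carrier) (C : Set 𝒱.carrier) (P : Set (Kerr.region a M)) (ρ : ℝ),
    |a| < M →
    B = starBackground mo.1 mo.2 M a (fun x => Kerr.radius a (poincareInv mo.1 mo.2 x)) →
    Φ₀ '' pullK mo M a B (slabK M a) ⊆ C → C ⊆ range 𝒱.embed →
    -- `P` open, inside `W`, past-closed in `W` (closed form), with compact truncated pasts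
    IsOpen P → P ⊆ interior (JK M a hM (slabK M a)) →
    (∀ x ∈ P, closure (JKpast M a hM {x}) ∩ interior (JK M a hM (slabK M a)) ⊆ P) →
    (∀ x ∈ P, closure (JKpast M a hM {x}) ∩ frontier (JK M a hM (slabK M a)) ⊆
      slabK M a ∪ (roofK M a hM ∩ {y | Kerr.radius a y.1 ≤ ρ})) →
    (∀ x ∈ P, IsCompact (closure (JKpast M a hM {x}) ∩ closure (JK M a hM (slabK M a)))) →
    -- `Ψ` exact, t.o.p., open embedding on `pullK P`, image in `J⁺(C)`
    ContMDiffOn 𝓘(ℝ, E4) (𝓡 4) ∞ Ψ (pullK mo M a B P) →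
    IsOpenEmbedding ((pullK mo M a B P).restrict Ψ) →
    Ψ '' pullK mo M a B P ⊆ 𝒱.metric.causalFuture 𝒱.timeOrientation C →
    supCkENorm (Subtype.val '' pullK mo M a B P) 0 (𝒱.toSpacetime.deviationExtend B Ψ) ≤ 0 →
    (∀ x ∈ pullK mo M a B P, 𝒱.timeOrientation.IsFutureDirected
      (mfderiv 𝓘(ℝ, E4) (𝓡 4) Ψ x ((mo.1 : E4 ≃L[ℝ] E4) (Kerr.timeVector M a (poincareInv mo.1 mo.2 x.1))))) →
    -- boundary behaviour
    ContinuousOn Ψ (pullK mo M a B (P ∪ slabK M a ∪ (roofK M a hM ∩ {y | Kerr.radius a y.1 ≤ ρ}))) →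
    (∀ x ∈ pullK mo M a B (slabK M a), Ψ x = Φ₀ x) →
    Ψ '' pullK mo M a B (roofK M a hM ∩ {y | Kerr.radius a y.1 ≤ ρ}) ⊆
      frontier (𝒱.metric.causalFuture 𝒱.timeOrientation C) →
    ∀ x ∈ pullK mo M a B P,
      𝒱.metric.causalPast 𝒱.timeOrientation {Ψ x} ∩ 𝒱.metric.chronologicalFuture 𝒱.timeOrientation C ⊆
        Ψ '' pullK mo M a B P

/-- **Chart-gluing lemma** (step (D): exact charts agreeing on an open set agree on the connected
overlap).  Two exact charts `Ψ₁`, `Ψ₂` of the collar background on the pull-backs of open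
Kerr-side sets `U₁`, `U₂`, with `U₁ ∩ U₂` CONNECTED, which agree on the pull-back of a nonempty
open `A ⊆ U₁ ∩ U₂`, agree on the pull-back of `U₁ ∩ U₂`.  Paper proof: an exact chart is an
isometric immersion of `(pullK U, g_{Kerr,Λ,c})` into `𝒱` (deviation `0` ⇒ `Ψ^* g = g_B` with
`g_B` nondegenerate ⇒ `dΨ` injective); two isometric immersions agreeing on an open set have the
same 1-jet at a point, hence agree on the connected domain — the tree's
`PseudoRiemannianMetric.IsIsometricImmersion.eq_of_oneJet_eq` (O'Neill 1983, Prop. 3.62;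
Sbierski 2016, §3.1).  MISSING only the packaging of the boosted Kerr form on `B.domain` as a
`PseudoRiemannianMetric` (cf. `KerrSchildChartCovariance`). (ref: ONeill1983, Ch. 3, Prop. 3.62)
Route-posited statement; nothing is asserted. [conjecture] [folklore] -/
def ExactChartGluing : Prop :=
  ∀ [Kerr.Facts] (𝒮 : Spacetime.{0} 4) (M a : ℝ) (mo : lorentzGroup × E4) (B : ModelBackground)
    (Ψ₁ Ψ₂ : B.domain → 𝒮.carrier) (U₁ U₂ A : Set (Kerr.region a M)),
    0 < M → |a| < M →
    B = starBackground mo.1 mo.2 M a (fun x => Kerr.radius a (poincareInv mo.1 mo.2 x)) →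
    IsOpen U₁ → IsOpen U₂ → IsConnected (U₁ ∩ U₂) → IsOpen A → A.Nonempty → A ⊆ U₁ ∩ U₂ →
    ContMDiffOn 𝓘(ℝ, E4) (𝓡 4) ∞ Ψ₁ (pullK mo M a B U₁) →
    supCkENorm (Subtype.val '' pullK mo M a B U₁) 0 (𝒮.deviationExtend B Ψ₁) ≤ 0 →
    ContMDiffOn 𝓘(ℝ, E4) (𝓡 4) ∞ Ψ₂ (pullK mo M a B U₂) →
    supCkENorm (Subtype.val '' pullK mo M a B U₂) 0 (𝒮.deviationExtend B Ψ₂) ≤ 0 →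
    (∀ x ∈ pullK mo M a B A, Ψ₁ x = Ψ₂ x) →
    ∀ x ∈ pullK mo M a B (U₁ ∩ U₂), Ψ₁ x = Ψ₂ x

/-- **MARCHING LEMMA** (the honest content of the corrected F5): under the hypotheses of
`RoofDevelopmentExtensionCollar`, for every `T₀` there is an exact chart of the collar background
on the pull-back of the WHOLE slab of the open causal future below `T₀`,
`J⁺_K(slab)° ∩ {t* < T₀}`, with image in `J⁺(C)`.  Paper proof (report §4): choose `ρ'` beyond
the `η`-light-cone reach of the slab at time `T₀ + 1` (speed limit, §2) and the boundary-collar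
chart `(O, Ψ_E)` for `ρ'`; let `δ₀ > 0` be a Lebesgue number (`N_{δ₀}(roof portion) ∩ W ⊆ O`);
march in steps `h ≍ δ₀`: at level `τ` the slice piece `Σ_τ = {t* = τ} ∩ (W − (h/2) e₀)` lies, with
a neighbourhood, in the current chart domain `U_τ ⊇ W ∩ {t* ≤ τ}` (a past set of `W`); its image
is ACAUSAL in `𝒱` (`ExactChartPastSet`) and carries the `τ`-translate of `Kerr.data`
(`Kerr.dataEmbedding`, `KerrSchildTimeTranslation`, `HypersurfaceNaturality`); the Kerr KITE over
`Σ_τ` (erosion at unit `η`-speed of the shifted slice, vertical inner wall `{r = M}` justified by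
`strictAntiOn_radius`, Cauchy by the clock argument of `SwallowTheDatum.KerrShieldedSettles.stub_collarCauchy`)
is a vacuum Cauchy development of that datum (`Kerr.isRicciFlat_holds`), realised inside the
MAXIMAL `𝒱` over `Ψ_τ|Σ_τ` by
`CaptureSufficesC2.Sketch.stub_hypersurfaceMGHDRealised_of_choquetBruhatGeroch` (conditional on
`choquetBruhat_geroch_exists_mghd_cauchy`) and the maximality of the realised development; glue
by `ExactChartGluing` (overlap connected by construction), injectivity by `ExactChartPastSet`;
the strip of `W ∩ {τ < t* ≤ τ + h}` not covered by the kite lies within `2h` of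
`∂W ⊆ slab ∪ roofK` (`SlabFrontier`; segment argument), hence in `Δ½ ∪ O` (`SlabFutureContainsCylinder`),
already charted; `⌈T₀/h⌉` steps.  Conditional on: `choquetBruhat_geroch_exists_mghd_cauchy`
(named), `SlabFutureContainsCylinder`, `SlabFrontier` (K2c), `ExactChartPastSet`,
`ExactChartGluing`.  Route-posited statement; nothing is asserted. [conjecture] [folklore] -/
def MarchingLemma : Prop :=
  ∀ [Kerr.Facts] (k' : ℕ), 1 ≤ k' →
    ∀ (X : Type) [TopologicalSpace X] [ChartedSpace E3 X] [IsManifold (𝓡 3) ∞ X]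
      [T2Space X] [SecondCountableTopology X] [ConnectedSpace X]
      (D : InitialDataSet (𝓡 3) X) (𝒱 : VacuumCauchyDevelopment D)
      (M a : Fin 1 → ℝ) (p : 𝒱.carrier) (mo : Fin 1 → lorentzGroup × E4)
      (B : Fin 1 → ModelBackground) (Φ : ∀ i, (B i).domain → 𝒱.carrier)
      (hmax : 𝒱.IsMaximal) (hpar : ∀ i, 0 < M i ∧ |a i| < M i),
    (∃ i, p ∈ Φ i '' (B i).truncTimeSlab (3 * M i) 0) →
    (∀ i, B i = starBackground (mo i).1 (mo i).2 (M i) (a i)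
      (fun x => Kerr.radius (a i) (poincareInv (mo i).1 (mo i).2 x))) →
    (∀ i, ContMDiffOn 𝓘(ℝ, E4) (𝓡 4) ∞ (Φ i)
        {x | -1 < (B i).time x.1 ∧ (B i).time x.1 < 1 ∧ (B i).radius x.1 < 3 * M i + 1} ∧
      IsOpenEmbedding ({x | -1 < (B i).time x.1 ∧ (B i).time x.1 < 1 ∧
        (B i).radius x.1 < 3 * M i + 1}.restrict (Φ i))) →
    (∀ i, 𝒱.toSpacetime.truncDeviationCk (B i) (Φ i) k' (3 * M i) 0 ≤ 0) →
    CollarFutureOriented 𝒱 M mo B Φ →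
    collarCore M p B Φ ⊆ range 𝒱.embed →
    (∀ ρ : ℝ, ∃ (O : Set (Kerr.region (a 0) (M 0))) (Ψ : (B 0).domain → 𝒱.carrier),
      IsBoundaryCollarChart (mo 0) (M 0) (a 0) (hpar 0).1 (B 0) (collarCore M p B Φ)
        (𝒱.metric.causalFuture 𝒱.timeOrientation (collarCore M p B Φ)) (Φ 0) ρ O Ψ) →
    ∀ T₀ : ℝ, ∃ Ψ : (B 0).domain → 𝒱.carrier,
      ContMDiffOn 𝓘(ℝ, E4) (𝓡 4) ∞ Ψ
        (pullK (mo 0) (M 0) (a 0) (B 0) (interior (JK (M 0) (a 0) (hpar 0).1 (slabK (M 0) (a 0))) ∩ {y | y.1 0 < T₀})) ∧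
      IsOpenEmbedding ((pullK (mo 0) (M 0) (a 0) (B 0)
        (interior (JK (M 0) (a 0) (hpar 0).1 (slabK (M 0) (a 0))) ∩ {y | y.1 0 < T₀})).restrict Ψ) ∧
      Ψ '' pullK (mo 0) (M 0) (a 0) (B 0) (interior (JK (M 0) (a 0) (hpar 0).1 (slabK (M 0) (a 0))) ∩ {y | y.1 0 < T₀}) ⊆
        𝒱.metric.causalFuture 𝒱.timeOrientation (collarCore M p B Φ) ∧
      supCkENorm (Subtype.val '' pullK (mo 0) (M 0) (a 0) (B 0)
        (interior (JK (M 0) (a 0) (hpar 0).1 (slabK (M 0) (a 0))) ∩ {y | y.1 0 < T₀})) 0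
        (𝒱.toSpacetime.deviationExtend (B 0) Ψ) ≤ 0

/-- **The corrected F5 follows from the marching lemma** (checked reduction: restrict the chart on
`J⁺_K(slab)° ∩ {t* < T₀}` to its open sub-region `truncFutureK ρ T₀`; `exactOn_pullK_mono` with
the openness of `truncFutureK`). -/
theorem roofDevelopmentExtensionCollar_of_marching (hm : MarchingLemma) :
    RoofDevelopmentExtensionCollar := by
  intro _ k' hk' X _ _ _ _ _ _ D 𝒱 M a p mo B Φ hmax hpar hp hB hΦ hdev hor hCX hcoll ρ T₀
  obtain ⟨Ψ, hs, he, hJ, hd⟩ := hm k' hk' X D 𝒱 M a p mo B Φ hmax hpar hp hB hΦ hdev hor hCX hcoll T₀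
  exact ⟨Ψ, exactOn_pullK_mono (hB 0) hs he hJ hd (truncFutureK_subset (M 0) (a 0) (hpar 0).1 ρ T₀)
    (isOpen_truncFutureK (M 0) (a 0) (hpar 0).1 ρ T₀)⟩

end Marching

/-! ## §5 The limit-category block is blind to the time orientation (proved) -/

section Blind

/-- **Orientation-blindness of the limit-category hypothesis block.**  For a vacuum Cauchy
development `𝒱` of `D`, its TIME REVERSAL `𝒱.reverse` (same Lorentzian manifold, same embedding
of `X`, orientation `−T`, normal `−ν`; a vacuum Cauchy development of `(h, −k)`, §0) satisfies
VERBATIM every hypothesis of F1 / F5 / K2 that `𝒱` satisfies — maximality (`IsMaximal.reverse`),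
`p` in a collar, the layer embeddings (C2), the EXACT JET (C3) (`truncDeviationCk` sees only the
metric), the core on the slice — while its causal future of the core is the causal PAST of the
core in `𝒱`.  Hence any statement over this block whose conclusion lives in `J⁺_𝒱(C)` and is not
time-symmetric (ingoing Kerr-star boxes, F1's diamond chart, F5's chart on `J⁺_K(slab)°`) is
refuted as soon as ONE correctly oriented instance exists whose reversal still carries the
remaining, orientation-sensitive hypotheses (for F5: roof charts — supplied in reversed
Schwarzschild by the static-time reflection; report §2).  The cure is `CollarFutureOriented`. -/
theorem collarBlock_reverse {X : Type} [TopologicalSpace X] [ChartedSpace E3 X] [IsManifold (𝓡 3) ∞ X]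
    [ConnectedSpace X] {D : InitialDataSet (𝓡 3) X} (𝒱 : VacuumCauchyDevelopment D)
    (k' : ℕ) {N : ℕ} (M : Fin N → ℝ) (p : 𝒱.carrier) (B : Fin N → ModelBackground)
    (Φ : ∀ i, (B i).domain → 𝒱.carrier) (hmax : 𝒱.IsMaximal)
    (hp : ∃ i, p ∈ Φ i '' (B i).truncTimeSlab (3 * M i) 0)
    (hΦ : ∀ i, ContMDiffOn 𝓘(ℝ, E4) (𝓡 4) ∞ (Φ i)
        {x | -1 < (B i).time x.1 ∧ (B i).time x.1 < 1 ∧ (B i).radius x.1 < 3 * M i + 1} ∧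
      IsOpenEmbedding ({x | -1 < (B i).time x.1 ∧ (B i).time x.1 < 1 ∧
        (B i).radius x.1 < 3 * M i + 1}.restrict (Φ i)))
    (hdev : ∀ i, 𝒱.toSpacetime.truncDeviationCk (B i) (Φ i) k' (3 * M i) 0 ≤ 0)
    (hCX : collarCore M p B Φ ⊆ range 𝒱.embed) :
    𝒱.reverse.IsMaximal ∧
    (∃ i, p ∈ (Φ i : (B i).domain → 𝒱.reverse.carrier) '' (B i).truncTimeSlab (3 * M i) 0) ∧
    (∀ i, ContMDiffOn 𝓘(ℝ, E4) (𝓡 4) ∞ (Φ i : (B i).domain → 𝒱.reverse.carrier)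
        {x | -1 < (B i).time x.1 ∧ (B i).time x.1 < 1 ∧ (B i).radius x.1 < 3 * M i + 1} ∧
      IsOpenEmbedding ({x | -1 < (B i).time x.1 ∧ (B i).time x.1 < 1 ∧
        (B i).radius x.1 < 3 * M i + 1}.restrict (Φ i : (B i).domain → 𝒱.reverse.carrier))) ∧
    (∀ i, 𝒱.reverse.toSpacetime.truncDeviationCk (B i) (Φ i) k' (3 * M i) 0 ≤ 0) ∧
    collarCore M p B Φ ⊆ range 𝒱.reverse.embed ∧
    𝒱.reverse.metric.causalFuture 𝒱.reverse.timeOrientation (collarCore M p B Φ) =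
      𝒱.metric.causalPast 𝒱.timeOrientation (collarCore M p B Φ) :=
  ⟨hmax.reverse, hp, hΦ, hdev, hCX, rfl⟩

end Blind

end K2Route

end Summit.FinalStateConjecture.FinalStateConjecture.Theorems.BondiBartnikRigidity.DirectMethod

end
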